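import Mathlib.GroupTheory.SpecificGroups.Cyclic
import Mathlib.GroupTheory.QuotientGroup.Basic
import Mathlib.GroupTheory.OrderOfElement
import HarnessLib

/-!
# Three group lemmas behind the decomposition involution of `K[9pn]/K` at `w = (√−3)`
# (crux `UpperOffV0HSYPlus`, stmt-BirchSwinnertonDyer-19804, stub (W2-b) `stub_levelFixingSeven`)

Cell `bsd-cm`, seat `bsd-cm-k7t-c2` g32.  The skeleton of record VARIANT R
(`Cruxes/UpperOffV0HSYPlus/Lines/coupled_variantQ.lean` d0360d872ad7940b) carries ONE research stub,
(W2-b) `stub_levelFixingSeven`: «the involution `s` of the decomposition group at the ramified place `w ∣ 3` of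
`Gal(K[9pn]/K)`, `K = ℚ(ω)`, fixes Hu–Shu–Yin's CM points `y_n` of conductor `9pn` on `X₀(3⁵)/S₃ = E₉`».  The seat
memo `W2B-RECIPROCITY-k7t-c2-g32.md` (evidence #50 on the crux item) proves it on paper by Hu–Shu–Yin's own method
(Trans. AMS 372 (2019), §2.2 Thm. 2.2/2.3: Shimura reciprocity `P₀^{σ_t} = [τ, ρ(t)]_{U₀}` and an explicit element
`W A^{i(p mod 27, n mod 3)}` of the normaliser of `Γ₀(3⁵)`), and isolates the tree gap: the CM action on singular moduli
of the ORDER `𝒪_{9pn}` must be compared with the tree's Artin isomorphism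
`Φ_c : Gal(K[c]/K) ≃* Pic(𝒪_c)` (`exists_mulEquiv_aut_classGroup_quadOrder`) WITHOUT naming the Artin symbol at `w`
(every Deuring–Kronecker argument is void at `w`: all `j`-values of `𝒪_{9pn}`-classes reduce to the one supersingular
`j = 0` in characteristic `3`).  The memo's two routes around the name (§4.1 at `n = 1`, §4.2 for all `n`) rest on
exactly three pieces of finite group theory, proved here once, Mathlib-only, for the later assembler files:

* `eq_of_mul_self_eq_one_of_odd_card_ker` — **a homomorphism with a kernel of odd order is injective on
  `2`-torsion** (`s² = t² = 1`, `f s = f t` ⇒ `s = t`, commutative source): the «unique `2`-torsion lift through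
  the odd kernel `ker(Pic(𝒪_{9pn}) → Pic(𝒪_{pn}))` of order `9`» of §4.2 and the step `N[2] = 1` of §4.1;
* `eq_of_mul_self_eq_one_of_isCyclic` — a finite cyclic group has at most one element of order `2`;
  `eq_of_mul_self_eq_one_of_odd_card_of_isCyclic_quotient` — **a commutative group with a subgroup `N` of odd
  order and cyclic finite quotient `G ⧸ N` has at most one element of order `2`**: with `G = Gal(K[9p]/K)`,
  `N = Gal(K[9p]/K[p])` of order `9` (`JZero.card_ringClassGalOver_nine_mul`) and `G ⧸ N ≅ Gal(K[p]/K) ≅ Pic(𝒪_p)`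
  cyclic of order `(p − 1)/3`, this is «`Gal(K[9p]/K)` has a UNIQUE involution» (§4.1, memo §2 (e): `Pic(𝒪_{9p})[2] =
  {1, η*}` certified for `p = 7, 43, 61`), so the decomposition involution `s` equals ANY non-trivial involution
  `σ′` transporting `τ₁ ↦ WA^{i}τ₁` (B-I `exists_ringEquiv_levelTransport_of_residue_congr_bezout`);
  the hypothesis-form `eq_of_mul_self_eq_one_of_odd_card_of_quotient` asks only that the quotient have at most
  one element of order `2`;
* `MonoidHom.forall_eq_self_or_forall_eq_inv` — **an endomorphism `ψ` of a commutative group with `ψ x ∈ {x, x⁻¹}`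
  for every `x` is the identity or the inversion** (a group is not the union of two proper subgroups): with
  `ψ = η_c ∘ Φ_c⁻¹` (Hasse's CM translation class against the Artin class, which agree up to `±` class by class by
  Deuring's dichotomy at good split primes, `exists_kronecker_dichotomy_modulus`) this gives `η_c = Φ_c^{±1}`, and
  the sign dies on the `2`-torsion class `η* = [(243, 243pn, 61(pn)²)]` of `s` (§4.2).

HONEST LABEL: group theory only; nothing here mentions a curve, a field or a Heegner point; no stub is closed;
nothing is asserted on 19804; X12.CMAtTwo NOT proved; BSD is proved for no curve.  Sources for the USE of these
lemmas: [HuShuYin2019] §2.1 Prop. 2.1, §2.2 Thm. 2.2–2.3, Prop. 2.4; [Cox2013] §7.D Thm. 7.24 / Cor. 7.28 (the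
odd kernel), §9.A; [GrossLMS1991] §3 (`0 → G_n → 𝒢_n → Gal(K_1/K) → 0`).

## Mathlib search
`IsCyclic.card_pow_eq_one_le` (a finite cyclic group has `≤ n` solutions of `xⁿ = 1`), `orderOf_eq_prime`,
`Subgroup.orderOf_coe`/`Subgroup.orderOf_mk`, `orderOf_dvd_natCard`, `QuotientGroup.ker_mk'`,
`QuotientGroup.eq_one_iff`; `lean search 'mul_self_eq_one.*odd|Odd.*card.*ker.*inj'` → no packaged statement.
-/

set_option linter.dupNamespace false -- Summits modules are `Summit.<Summit>.<Problem>…` by design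
set_option autoImplicit false

namespace Summit.BirchSwinnertonDyer.BirchSwinnertonDyer.Theorems.SylvesterTwoLevelFixing

/-! ### §1 Odd kernels see `2`-torsion faithfully -/

/-- In a group of odd (finite) order the only element squaring to `1` is `1` (an element `s ≠ 1` with
`s² = 1` has order `2 ∣ #G`).  [folklore] -/
theorem eq_one_of_mul_self_eq_one_of_odd_card {G : Type*} [Group G] (hG : Odd (Nat.card G))
    {s : G} (hs : s * s = 1) : s = 1 := by
  by_contra h
  have h2 : orderOf s = 2 := orderOf_eq_prime (by rw [pow_two]; exact hs) h
  have hdvd : 2 ∣ Nat.card G := h2 ▸ orderOf_dvd_natCard s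
  exact (Nat.not_even_iff_odd.mpr hG) (even_iff_two_dvd.mpr hdvd)

/-- In a subgroup of odd order the only element squaring to `1` is `1`. [folklore] -/
theorem eq_one_of_mul_self_eq_one_of_mem_of_odd_card {G : Type*} [Group G] {N : Subgroup G}
    (hN : Odd (Nat.card N)) {s : G} (hsN : s ∈ N) (hs : s * s = 1) : s = 1 := by
  have h : (⟨s, hsN⟩ : N) = 1 :=
    eq_one_of_mul_self_eq_one_of_odd_card hN (Subtype.ext (by simpa using hs))
  simpa using congrArg Subtype.val h

/-- **A homomorphism out of a commutative group whose kernel has odd order is injective on `2`-torsion**: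
if `s² = t² = 1` and `f s = f t` then `s = t` (`st⁻¹` is a `2`-torsion element of the kernel).  This is the
«unique `2`-torsion lift through an odd kernel» of the seat memo §4.2 (kernel `Pic(𝒪_{9pn}) → Pic(𝒪_{pn})` of
order `9`) and the step `N[2] = 1` of §4.1. [folklore] -/
theorem eq_of_mul_self_eq_one_of_odd_card_ker {G H : Type*} [CommGroup G] [Group H] (f : G →* H)
    (hker : Odd (Nat.card f.ker)) {s t : G} (hs : s * s = 1) (ht : t * t = 1) (hst : f s = f t) :
    s = t := by
  have hmem : s * t⁻¹ ∈ f.ker := by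
    rw [MonoidHom.mem_ker, map_mul, map_inv, hst, mul_inv_cancel]
  have hsq : (s * t⁻¹) * (s * t⁻¹) = 1 := by
    have ht' : t⁻¹ * t⁻¹ = 1 := by
      rw [← mul_inv, inv_eq_one]; exact ht
    calc (s * t⁻¹) * (s * t⁻¹) = (s * s) * (t⁻¹ * t⁻¹) := by rw [mul_mul_mul_comm]
      _ = 1 := by rw [hs, ht', mul_one]
  have h1 : s * t⁻¹ = 1 := eq_one_of_mul_self_eq_one_of_mem_of_odd_card hker hmem hsq
  rwa [mul_inv_eq_one] at h1

/-! ### §2 At most one element of order `2` -/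

/-- **A finite cyclic group has at most one element of order `2`** (the solutions of `x² = 1` number at most
`2`, `IsCyclic.card_pow_eq_one_le`, and `1` is one of them). [folklore] -/
theorem eq_of_mul_self_eq_one_of_isCyclic {G : Type*} [Group G] [Finite G] [IsCyclic G] {s t : G}
    (hs : s * s = 1) (ht : t * t = 1) (hs1 : s ≠ 1) (ht1 : t ≠ 1) : s = t := by
  classical
  by_contra hne
  let _ : Fintype G := Fintype.ofFinite G
  have hle := IsCyclic.card_pow_eq_one_le (α := G) (n := 2) two_pos
  have hsub : ({1, s, t} : Finset G) ⊆ Finset.univ.filter (fun a : G => a ^ 2 = 1) := by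
    intro a ha
    simp only [Finset.mem_insert, Finset.mem_singleton] at ha
    simp only [Finset.mem_filter, Finset.mem_univ, true_and]
    rcases ha with rfl | rfl | rfl
    · exact one_pow 2
    · rw [pow_two]; exact hs
    · rw [pow_two]; exact ht
  have hcard : ({1, s, t} : Finset G).card = 3 := by
    rw [Finset.card_insert_of_notMem, Finset.card_insert_of_notMem, Finset.card_singleton]
    · simpa using hne
    · simp only [Finset.mem_insert, Finset.mem_singleton, not_or]
      exact ⟨fun h => hs1 h.symm, fun h => ht1 h.symm⟩
  have := (hcard.symm.le.trans (Finset.card_le_card hsub)).trans hle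
  omega

/-- **At most one element of order `2` in a commutative group with a subgroup `N` of odd order whose quotient
has at most one element of order `2`** (hypothesis form): two non-trivial involutions `s, t` have non-trivial
images in `G ⧸ N` (else they would be `2`-torsion in `N`), the images coincide, and `st⁻¹ ∈ N` is `2`-torsion,
hence trivial. [folklore] -/
theorem eq_of_mul_self_eq_one_of_odd_card_of_quotient {G : Type*} [CommGroup G] (N : Subgroup G)
    (hN : Odd (Nat.card N))
    (hq : ∀ a b : G ⧸ N, a * a = 1 → b * b = 1 → a ≠ 1 → b ≠ 1 → a = b)
    {s t : G} (hs : s * s = 1) (ht : t * t = 1) (hs1 : s ≠ 1) (ht1 : t ≠ 1) : s = t := by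
  have hker : Odd (Nat.card (QuotientGroup.mk' N).ker) := by rwa [QuotientGroup.ker_mk']
  have himg : ∀ {u : G}, u * u = 1 → u ≠ 1 → (QuotientGroup.mk' N u) * (QuotientGroup.mk' N u) = 1 ∧
      QuotientGroup.mk' N u ≠ 1 := by
    intro u hu hu1
    refine ⟨by rw [← map_mul, hu, map_one], fun h => hu1 ?_⟩
    exact eq_of_mul_self_eq_one_of_odd_card_ker (QuotientGroup.mk' N) hker hu (one_mul 1)
      (h.trans (map_one _).symm)
  obtain ⟨hs2, hs3⟩ := himg hs hs1
  obtain ⟨ht2, ht3⟩ := himg ht ht1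
  exact eq_of_mul_self_eq_one_of_odd_card_ker (QuotientGroup.mk' N) hker hs ht (hq _ _ hs2 ht2 hs3 ht3)

/-- **At most one element of order `2` in a commutative group `G` with a subgroup `N` of odd order and CYCLIC
finite quotient `G ⧸ N`.**  The instance used by the seat memo §4.1: `G = Gal(K[9p]/K)` (`K = ℚ(ω)`, `p ≡ 1 (3)`),
`N = Gal(K[9p]/K[p])` of order `9`, `G ⧸ N ≅ Gal(K[p]/K) ≅ Pic(𝒪_p)` cyclic of order `(p − 1)/3` — so the
decomposition involution at `w = (√−3)` is THE involution of `Gal(K[9p]/K)`. [folklore] -/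
theorem eq_of_mul_self_eq_one_of_odd_card_of_isCyclic_quotient {G : Type*} [CommGroup G] (N : Subgroup G)
    (hN : Odd (Nat.card N)) [Finite (G ⧸ N)] [IsCyclic (G ⧸ N)]
    {s t : G} (hs : s * s = 1) (ht : t * t = 1) (hs1 : s ≠ 1) (ht1 : t ≠ 1) : s = t :=
  eq_of_mul_self_eq_one_of_odd_card_of_quotient N hN
    (fun _ _ ha hb ha1 hb1 => eq_of_mul_self_eq_one_of_isCyclic ha hb ha1 hb1) hs ht hs1 ht1

/-- Transport form: the same uniqueness through ANY homomorphism `f : G →* Q` with odd kernel onto a group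
with at most one element of order `2` (e.g. a restriction map `Gal(K[9p]/K) → Gal(K[p]/K)` given abstractly rather
than as a quotient). [folklore] -/
theorem eq_of_mul_self_eq_one_of_odd_card_ker_of_target {G Q : Type*} [CommGroup G] [Group Q] (f : G →* Q)
    (hker : Odd (Nat.card f.ker))
    (hq : ∀ a b : Q, a * a = 1 → b * b = 1 → a ≠ 1 → b ≠ 1 → a = b)
    {s t : G} (hs : s * s = 1) (ht : t * t = 1) (hs1 : s ≠ 1) (ht1 : t ≠ 1) : s = t := by
  have himg : ∀ {u : G}, u * u = 1 → u ≠ 1 → f u * f u = 1 ∧ f u ≠ 1 := by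
    intro u hu hu1
    refine ⟨by rw [← map_mul, hu, map_one], fun h => hu1 ?_⟩
    exact eq_of_mul_self_eq_one_of_odd_card_ker f hker hu (one_mul 1) (h.trans (map_one _).symm)
  obtain ⟨hs2, hs3⟩ := himg hs hs1
  obtain ⟨ht2, ht3⟩ := himg ht ht1
  exact eq_of_mul_self_eq_one_of_odd_card_ker f hker hs ht (hq _ _ hs2 ht2 hs3 ht3)

/-! ### §3 `ψ x ∈ {x, x⁻¹}` for all `x` forces `ψ = id` or `ψ = inv` -/

/-- **An endomorphism `ψ` of a commutative group with `ψ x = x ∨ ψ x = x⁻¹` for every `x` is the identity or the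
inversion** — the fixed sets `{ψ x = x}` and `{ψ x = x⁻¹}` are subgroups covering the group, and a group is not the
union of two proper subgroups (if `ψ a = a⁻¹ ≠ a` and `ψ b = b ≠ b⁻¹`, then `ψ(ab) = a⁻¹b` is neither `ab` nor
`(ab)⁻¹`).  A deliberate dot-notation extension of Mathlib's `MonoidHom` namespace.  Use (seat memo §4.2): `ψ = η_c ∘ Φ_c⁻¹` on `Pic(𝒪_c)`, Hasse's CM translation class against the Artin
class, which Deuring's dichotomy at good split primes makes agree up to `±` class by class; hence `η_c = Φ_c^{±1}`
and on a `2`-torsion class the sign is immaterial. [folklore] -/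
theorem _root_.MonoidHom.forall_eq_self_or_forall_eq_inv {A : Type*} [CommGroup A] (ψ : A →* A)
    (h : ∀ x, ψ x = x ∨ ψ x = x⁻¹) : (∀ x, ψ x = x) ∨ (∀ x, ψ x = x⁻¹) := by
  by_contra hcon
  rw [not_or, not_forall, not_forall] at hcon
  obtain ⟨⟨a, ha⟩, ⟨b, hb⟩⟩ := hcon
  have ha' : ψ a = a⁻¹ := (h a).resolve_left ha
  have hb' : ψ b = b := (h b).resolve_right hb
  have hab : ψ (a * b) = a⁻¹ * b := by rw [map_mul, ha', hb']
  rcases h (a * b) with h1 | h1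
  · -- `a⁻¹ b = a b` ⇒ `a⁻¹ = a` ⇒ `ψ a = a`
    rw [hab] at h1
    exact ha (ha'.trans (mul_right_cancel h1))
  · -- `a⁻¹ b = (ab)⁻¹ = a⁻¹ b⁻¹` ⇒ `b = b⁻¹` ⇒ `ψ b = b⁻¹`
    rw [hab, mul_inv] at h1
    exact hb (hb'.trans (mul_left_cancel h1))

/-- The same for a map between two commutative groups compared along an isomorphism `e : A ≃* B`
(`f x = e x ∨ f x = (e x)⁻¹` for all `x` ⇒ one alternative holds uniformly; a deliberate dot-notation extension of Mathlib's `MonoidHom` namespace): the shape in which Hasse's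
`η_c : Gal → Pic(𝒪_c)` is compared with the Artin isomorphism `Φ_c`. [folklore] -/
theorem _root_.MonoidHom.forall_eq_or_forall_eq_inv_of_mulEquiv {A B : Type*} [CommGroup A] [CommGroup B]
    (f : A →* B) (e : A ≃* B) (h : ∀ x, f x = e x ∨ f x = (e x)⁻¹) :
    (∀ x, f x = e x) ∨ (∀ x, f x = (e x)⁻¹) := by
  have key := (f.comp e.symm.toMonoidHom).forall_eq_self_or_forall_eq_inv (fun y => by
    simpa using h (e.symm y))
  rcases key with k | k
  · left; intro x; simpa using k (e x)
  · right; intro x; simpa using k (e x)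

end Summit.BirchSwinnertonDyer.BirchSwinnertonDyer.Theorems.SylvesterTwoLevelFixing
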